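import Mathlib
import HarnessLib
import Summits.Ventures.LatticeQCDFlow.Scaling.CumulantDiagonalLimit
import Literature.Probability.LatticeModels.ForbiddenGapFirstOrder

/-!
# LatticeQCDFlow / Scaling — INVERSION OF THE LOSS: a converging total training loss
# `n·cgf(β_n) → D` pins the coupling, `β_n → 0` and `β_n·√n → √(2D/σ²)`

HONEST FRAMING: exact (Metropolis-corrected) sampling algorithms for lattice gauge theory;
figures of merit are autocorrelation/cost numbers at stated couplings and volumes; no
continuum-physics claim.

Venture `LatticeQCDFlow` (cell pub-lqcd), topic `Scaling`; FANOUT row 3 (`s0-u1-a`, S0-B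
implementation A, GEN-20).  NEW WORK of the cell (elementary), on row 3's
`Scaling/CumulantDiagonalLimit` (Lagrange form of `cgf`, `cgf″(0) = σ²`, continuity of `cgf″`),
Mathlib's Jensen / strict Jensen inequalities (`ConvexOn.map_integral_le`,
`StrictConvexOn.ae_eq_const_or_map_average_lt`) and the convexity of the cumulant generating
function (`Literature…ForbiddenGap.convexOn_cgf`, imported and reused); NO definition is introduced;
nothing is cited.  The converse direction — `β_n√n → c ⇒ n·cgf(β_n) → c²σ²/2` — is row 3's GEN-19
`Scaling/CumulantGeneralDiagonal`; together: for non-negative couplings of a bounded centred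
non-degenerate block statistic, `n·cgf(β_n) → D ⇔ β_n√n → √(2D/σ²)`.  The total reverse training
loss of the untrained `n`-block sampler IS `n·cgf(β)` (`Scaling/TiltKLDivergence`), so these are
statements about the loss; sequels read off the acceptance (`Scaling/AcceptanceAlongCouplingSequences`)
and the ESS (`Scaling/LossEssDictionary`).

## Content (all `[ours]`), `g` measurable, `|g| ≤ K`, `∫ g dν = 0`, `σ² = Var g`

* §0 (tools for the sequels, Mathlib only): `abs_integral_exp_neg_sq_Ioi_sub_le`,
  `continuous_integral_exp_neg_sq_Ioi`, `continuous_erfcProfile` (the profile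
  `c ↦ (2/√π)∫_{√(c²v)/2}^∞ e^{−u²} du` is continuous: the tail integral is 1-Lipschitz in its lower
  limit), `erfcProfile_zero` (`(2/√π)∫_0^∞ e^{−u²} du = 1`);
* `cgf_nonneg_of_centred` — `cgf(t) ≥ 0` (Jensen);
* **`cgf_pos_of_centred`** — `σ² ≠ 0`, `t ≠ 0` ⇒ `cgf(t) > 0` (strict Jensen: equality forces `g` a.e.
  constant);
* `cgf_le_cgf_of_centred` — `cgf` is non-decreasing on `[0, ∞)`;
* **`tendsto_zero_of_nat_mul_cgf_tendsto`** — `β_n ≥ 0`, `n·cgf(β_n) → D` ⇒ `β_n → 0`;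
* **`sqrt_mul_tendsto_of_nat_mul_cgf_tendsto`** — … ⇒ `β_n·√n → √(2D/σ²)`.

Reading (value-free): at large volume the training loss of the untrained sampler determines the
coupling scale: a bounded total loss forces couplings `O(n^{−1/2})`, with the constant read off
`D = c²σ²/2`.
NOT CLAIMED: negative couplings (symmetric under `g ↦ −g`); unbounded statistics; any value at the
cell's `(β, L)`; nothing re-scored.
-/

noncomputable section

namespace Summit.Ventures.LatticeQCDFlow.Theory2

open MeasureTheory ProbabilityTheory Filter Finset Real Set
open scoped Topology NNReal

/-! ## §0 The `erfc` profile `c ↦ (2/√π)∫_{√(c²v)/2}^∞ e^{−u²} du` is continuous -/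

section Profile

/-- The Gaussian tail integral is 1-Lipschitz in its lower limit. [folklore] -/
theorem abs_integral_exp_neg_sq_Ioi_sub_le (x y : ℝ) :
    |(∫ u in Ioi x, Real.exp (-u ^ 2)) - ∫ u in Ioi y, Real.exp (-u ^ 2)| ≤ |y - x| := by
  have hI : ∀ z : ℝ, IntegrableOn (fun u : ℝ => Real.exp (-u ^ 2)) (Ioi z) := fun z =>
    ((integrable_exp_neg_mul_sq zero_lt_one).integrableOn (s := Ioi z)).congr_fun
      (fun u _ => by simp) measurableSet_Ioi
  rw [intervalIntegral.integral_Ioi_sub_Ioi' (hI x) (hI y)]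
  have h := intervalIntegral.norm_integral_le_of_norm_le_const (a := x) (b := y) (C := 1)
    (f := fun u : ℝ => Real.exp (-u ^ 2)) (fun u _ => by
      rw [Real.norm_eq_abs, abs_of_pos (Real.exp_pos _), Real.exp_le_one_iff]
      nlinarith [sq_nonneg u])
  simpa [Real.norm_eq_abs] using h

/-- `x ↦ ∫_x^∞ e^{−u²} du` is continuous. [folklore] -/
theorem continuous_integral_exp_neg_sq_Ioi :
    Continuous fun x : ℝ => ∫ u in Ioi x, Real.exp (-u ^ 2) := by
  refine (LipschitzWith.of_dist_le_mul (K := 1) fun x y => ?_).continuous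
  rw [Real.dist_eq, Real.dist_eq, NNReal.coe_one, one_mul, abs_sub_comm x y]
  exact abs_integral_exp_neg_sq_Ioi_sub_le x y

/-- The diagonal profile `c ↦ (2/√π)∫_{√(c²v)/2}^∞ e^{−u²} du` is continuous. [ours] -/
theorem continuous_erfcProfile (v : ℝ) :
    Continuous fun c : ℝ => 2 / Real.sqrt Real.pi
      * ∫ u in Ioi (Real.sqrt (c ^ 2 * v) / 2), Real.exp (-u ^ 2) := by
  refine continuous_const.mul (continuous_integral_exp_neg_sq_Ioi.comp ?_)
  fun_prop

/-- `(2/√π)∫_0^∞ e^{−u²} du = 1`. [folklore] -/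
theorem erfcProfile_zero : 2 / Real.sqrt Real.pi * ∫ u in Ioi (0 : ℝ), Real.exp (-u ^ 2) = 1 := by
  have h := integral_gaussian_Ioi 1
  simp only [neg_mul, one_mul, div_one] at h
  rw [h]
  have hπ : 0 < Real.sqrt Real.pi := Real.sqrt_pos.2 Real.pi_pos
  field_simp

end Profile


/-! ## Inversion: the total loss `n·cgf(β_n) → D` forces `β_n√n → √(2D/σ²)` -/

section Inversion

variable {X : Type*} {mX : MeasurableSpace X} {ν : Measure X} [IsProbabilityMeasure ν] {g : X → ℝ}

/-- `cgf(t) ≥ 0` for a bounded centred statistic (Jensen). [folklore] -/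
theorem cgf_nonneg_of_centred (hgm : Measurable g) {K : ℝ} (hK : ∀ x, |g x| ≤ K)
    (h0 : ∫ x, g x ∂ν = 0) (t : ℝ) : 0 ≤ cgf g ν t := by
  have hgb : ∀ᵐ x ∂ν, g x ∈ Set.Icc (-K) K := ae_of_all _ fun x => abs_le.1 (hK x)
  have hgi : Integrable g ν := Integrable.of_mem_Icc (-K) K hgm.aemeasurable hgb
  have hexp : Integrable (fun x => Real.exp (t * g x)) ν := integrable_exp_mul_of_mem_Icc hgm.aemeasurable hgb
  have hJ := ConvexOn.map_integral_le (μ := ν) (f := fun x => t * g x) (g := Real.exp) (s := Set.univ)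
    convexOn_exp Real.continuous_exp.continuousOn isClosed_univ (ae_of_all _ fun _ => Set.mem_univ _)
    (hgi.const_mul t) hexp
  rw [integral_const_mul, h0, mul_zero, Real.exp_zero] at hJ
  exact Real.log_nonneg hJ

/-- **`cgf(t) > 0` for `t ≠ 0`** when the bounded centred statistic is non-degenerate (strict
Jensen: equality would force `g` a.e. constant, i.e. `Var g = 0`). [ours] -/
theorem cgf_pos_of_centred (hgm : Measurable g) {K : ℝ} (hK : ∀ x, |g x| ≤ K)
    (h0 : ∫ x, g x ∂ν = 0) (hσ : Var[g; ν] ≠ 0) {t : ℝ} (ht : t ≠ 0) : 0 < cgf g ν t := by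
  have hgb : ∀ᵐ x ∂ν, g x ∈ Set.Icc (-K) K := ae_of_all _ fun x => abs_le.1 (hK x)
  have hgi : Integrable g ν := Integrable.of_mem_Icc (-K) K hgm.aemeasurable hgb
  have hexp : Integrable (fun x => Real.exp (t * g x)) ν := integrable_exp_mul_of_mem_Icc hgm.aemeasurable hgb
  have hJ := StrictConvexOn.ae_eq_const_or_map_average_lt (μ := ν) (f := fun x => t * g x)
    (g := Real.exp) (s := Set.univ) strictConvexOn_exp Real.continuous_exp.continuousOn isClosed_univ
    (ae_of_all _ fun _ => Set.mem_univ _) (hgi.const_mul t) hexp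
  simp only [average_eq_integral, integral_const_mul, h0, mul_zero] at hJ
  rcases hJ with hconst | hlt
  · -- `t·g` is a.e. zero, hence `g` is a.e. zero and `Var g = 0`: contradiction
    exfalso
    apply hσ
    have hg0 : g =ᵐ[ν] fun _ => ∫ x, g x ∂ν := by
      rw [h0]
      filter_upwards [hconst] with x hx
      have hx' : t * g x = 0 := by simpa [Function.const] using hx
      rcases mul_eq_zero.1 hx' with h | h
      · exact absurd h ht
      · exact h
    have hev : eVar[g; ν] = 0 := (evariance_eq_zero_iff hgm.aemeasurable).2 hg0
    simp [variance, hev]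
  · rw [Real.exp_zero] at hlt
    exact Real.log_pos hlt

/-- `cgf` of a bounded centred statistic is non-decreasing on `[0, ∞)` (convex with minimum `0` at
`0`). [ours] -/
theorem cgf_le_cgf_of_centred (hgm : Measurable g) {K : ℝ} (hK : ∀ x, |g x| ≤ K)
    (h0 : ∫ x, g x ∂ν = 0) {s t : ℝ} (hs : 0 ≤ s) (hst : s ≤ t) : cgf g ν s ≤ cgf g ν t := by
  rcases hs.eq_or_lt with h | hs'
  · rw [← h, cgf_zero]
    exact cgf_nonneg_of_centred hgm hK h0 t
  have hconv := Literature.Probability.LatticeModels.ForbiddenGap.convexOn_cgf (μ := ν) hgm hK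
  refine hconv.le_right_of_left_le'' (Set.mem_univ 0) (Set.mem_univ t) hs' hst ?_
  rw [cgf_zero]
  exact cgf_nonneg_of_centred hgm hK h0 s

/-- **The loss pins the coupling, I**: `β_n ≥ 0` and `n·cgf(β_n) → D` force `β_n → 0`. [ours] -/
theorem tendsto_zero_of_nat_mul_cgf_tendsto (hgm : Measurable g) {K : ℝ} (hK : ∀ x, |g x| ≤ K)
    (h0 : ∫ x, g x ∂ν = 0) (hσ : Var[g; ν] ≠ 0) {β : ℕ → ℝ} (hβ0 : ∀ n, 0 ≤ β n) {D : ℝ}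
    (hD : Tendsto (fun n : ℕ => (n : ℝ) * cgf g ν (β n)) atTop (𝓝 D)) :
    Tendsto β atTop (𝓝 0) := by
  rw [tendsto_order]
  refine ⟨fun a ha => Filter.Eventually.of_forall fun n => ha.trans_le (hβ0 n), fun δ hδ => ?_⟩
  have hcδ : 0 < cgf g ν δ := cgf_pos_of_centred hgm hK h0 hσ hδ.ne'
  have h1 : ∀ᶠ n : ℕ in atTop, (n : ℝ) * cgf g ν (β n) < D + 1 :=
    (tendsto_order.1 hD).2 _ (lt_add_one D)
  have h2 : ∀ᶠ n : ℕ in atTop, D + 1 < (n : ℝ) * cgf g ν δ :=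
    (tendsto_natCast_atTop_atTop.atTop_mul_const hcδ).eventually_gt_atTop (D + 1)
  filter_upwards [h1, h2] with n hn1 hn2
  by_contra hcon
  push Not at hcon
  have hmono : cgf g ν δ ≤ cgf g ν (β n) := cgf_le_cgf_of_centred hgm hK h0 hδ.le hcon
  have : (n : ℝ) * cgf g ν δ ≤ (n : ℝ) * cgf g ν (β n) :=
    mul_le_mul_of_nonneg_left hmono (Nat.cast_nonneg n)
  linarith

/-- **The loss pins the coupling, II**: `β_n ≥ 0` and `n·cgf(β_n) → D` force `β_n·√n → √(2D/σ²)`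
(Lagrange form `cgf(β) = cgf″(u)β²/2`, `u ∈ (0, β)`, and `cgf″ → σ²` at `0`). [ours] -/
theorem sqrt_mul_tendsto_of_nat_mul_cgf_tendsto (hgm : Measurable g) {K : ℝ} (hK : ∀ x, |g x| ≤ K)
    (h0 : ∫ x, g x ∂ν = 0) (hσ : Var[g; ν] ≠ 0) {β : ℕ → ℝ} (hβ0 : ∀ n, 0 ≤ β n) {D : ℝ}
    (hD : Tendsto (fun n : ℕ => (n : ℝ) * cgf g ν (β n)) atTop (𝓝 D)) :
    Tendsto (fun n : ℕ => β n * Real.sqrt n) atTop (𝓝 (Real.sqrt (2 * D / Var[g; ν]))) := by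
  have hgb : ∀ᵐ x ∂ν, g x ∈ Set.Icc (-K) K := ae_of_all _ fun x => abs_le.1 (hK x)
  have hga : AEMeasurable g ν := hgm.aemeasurable
  have hv : 0 < Var[g; ν] := lt_of_le_of_ne (variance_nonneg _ _) (Ne.symm hσ)
  have hint : interior (integrableExpSet g ν) = Set.univ :=
    interior_integrableExpSet_eq_univ_of_mem_Icc hga hgb
  -- Lagrange form for each `n` with `β_n > 0`
  have hL : ∀ n : ℕ, 0 < β n → ∃ u ∈ Set.Ioo 0 (β n),
      cgf g ν (β n) = iteratedDeriv 2 (cgf g ν) u * β n ^ 2 / 2 := fun n hn =>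
    exists_cgf_eq_iteratedDeriv_two_cgf_mul hn h0 (by rw [hint]; exact Set.subset_univ _)
  classical
  let u : ℕ → ℝ := fun n => if hn : 0 < β n then (hL n hn).choose else 0
  have hu_mem : ∀ n, u n ∈ Set.Icc 0 (β n) := fun n => by
    by_cases hn : 0 < β n
    · simp only [u, hn, ↓reduceDIte]
      exact Set.Ioo_subset_Icc_self (hL n hn).choose_spec.1
    · simp only [u, hn, ↓reduceDIte]
      exact ⟨le_rfl, hβ0 n⟩
  have hu_eq : ∀ n, cgf g ν (β n) = iteratedDeriv 2 (cgf g ν) (u n) * β n ^ 2 / 2 := fun n => by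
    by_cases hn : 0 < β n
    · simp only [u, hn, ↓reduceDIte]
      exact (hL n hn).choose_spec.2
    · have hz : β n = 0 := le_antisymm (not_lt.1 hn) (hβ0 n)
      simp [hz, cgf_zero]
  -- `u_n → 0`, hence `cgf″(u_n) → σ²`
  have hβlim := tendsto_zero_of_nat_mul_cgf_tendsto hgm hK h0 hσ hβ0 hD
  have hu0 : Tendsto u atTop (𝓝 0) :=
    tendsto_of_tendsto_of_tendsto_of_le_of_le tendsto_const_nhds hβlim
      (fun n => (hu_mem n).1) (fun n => (hu_mem n).2)
  have hcont := (continuous_iteratedDeriv_two_cgf_of_mem_Icc hga hgb).continuousAt (x := (0 : ℝ))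
  have hlim2 : Tendsto (fun n => iteratedDeriv 2 (cgf g ν) (u n) / 2) atTop (𝓝 (Var[g; ν] / 2)) := by
    rw [← iteratedDeriv_two_cgf_zero_of_mem_Icc hga hgb]
    exact (hcont.tendsto.comp hu0).div_const 2
  -- `n β_n² = (n·cgf(β_n)) / (cgf″(u_n)/2)` eventually
  have hsq : Tendsto (fun n : ℕ => (n : ℝ) * β n ^ 2) atTop (𝓝 (D / (Var[g; ν] / 2))) := by
    have h := hD.div hlim2 (by positivity)
    refine h.congr' ?_
    have hev : ∀ᶠ n : ℕ in atTop, iteratedDeriv 2 (cgf g ν) (u n) / 2 ≠ 0 :=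
      hlim2.eventually_ne (by positivity)
    filter_upwards [hev] with n hn
    have hI : iteratedDeriv 2 (cgf g ν) (u n) ≠ 0 := fun h => hn (by rw [h, zero_div])
    rw [Pi.div_apply, hu_eq n]
    field_simp
  have e : D / (Var[g; ν] / 2) = 2 * D / Var[g; ν] := by field_simp
  rw [e] at hsq
  have h := hsq.sqrt
  refine h.congr fun n => ?_
  rw [Real.sqrt_mul (Nat.cast_nonneg n), Real.sqrt_sq (hβ0 n), mul_comm]

end Inversion


end Summit.Ventures.LatticeQCDFlow.Theory2

end
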